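import Mathlib
import HarnessLib
import Summits.HubbardSuperconductivity.HubbardSuperconductivity.Theorems.KLProgrammePerturbedFermiCurveHigherDerivsCurve

/-!
# Route `KLProgramme` — the GRADED GROWTH of the frame's Fermi-point map in the KL regime: `‖Dⁱ(toLp ∘ k_F^K)(θ)‖ ≤ (C₀(R)·2^{N+1})ⁱ`,
# `1 ≤ i ≤ 4`, `N = nScales β`, with `C₀` depending on the renormalisation package `R` ONLY (answer to N-(E3g))

Cell `gate-hubbard-kl`, seat hubbard-kl-k3c3-p3 (g2; row «implicit-function / monotonicity route»).  p1b's finding N-(E3g) (STATUS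
2026-08-26T22:58Z): with the single-constant bootstrap the graded curve constant of an admissible frame grows like `4^{8N}` per order, against
the room `4^{i(N+1)}` of the frozen (E3g) majorant `angBar`.  From the SHARP bounds of `…HigherDerivsFrame` (orders 3, 4 LINEAR in the frame's
order-3/4 sizes `A₃ ≤ Gfr₃U²4^{N+1}/3`, `A₄ ≤ Gfr₄U²16^{N+1}/15`) and the graded packaging of `…HigherDerivsCurve`, this module proves the
growth statement that settles the exponent question:

  for every `R` (`Gfr ≥ 0`) there are `c₃, U₀ > 0` and `C₀ ≥ 1` — `C₀` a function of `R.Gfr 3`, `R.Gfr 4` and the window's radial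
  transversality constant only, NOT of `c, U, β`, the frame, the angle or the volume — such that in the regime `0 < c ≤ c₃`, `0 < U ≤ U₀`,
  `klBetaMin ≤ β ≤ e^{c/U²}`, for every `μ ∈ klWindowC` and every `FrameOK R U (nScales β) μ K` frame,
  `‖Dⁱ(θ ↦ toLp 2 (klFermiPoint μ K θ))‖ ≤ (C₀·2^{nScales β + 1})ⁱ`, `1 ≤ i ≤ 4` (`fermiPointLp_graded_of_frameOK`).

So the curve factor `Dⁱ` in p1b's `twoLegAngularG_of_curve_bounds` is `≍ 2^{i(N+1)}`, leaving `angBar`'s other `2^{i(N+1)}` for the two-leg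
moments `m_i(n) ≲ |U|·4^{(i−2)⁺n}` — the exponents fit exactly at `i = 4`; what remains of the fit `i!·m·Dⁱ ≤ angBar` is numerals.  The proof
runs the incremental chain `R₁ → R₂ → R₃ → R₄` of `abs_deriv_*_frameRadius_le` with worst-case inputs (`A ≤ 1/20`, `Dt_min − 2A ≥ Dt_min/2`,
`U ≤ 1`), so that `R₁, R₂ = O(1)`, `R₃ ≤ r₃·4^{N+1}`, `R₄ ≤ r₄·16^{N+1}`, and feeds `norm_iteratedFDeriv_fermiPointLp_le_of_tower` with
`D = max(1, r₁, r₂, r₃, r₄)·2^{N+1}`.  Everything is PROVED; no definitions, nothing about the Hubbard model.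
References: BGM 2006 §2.4 Lemma 2.1 (2.40) [cite: BenfattoGiulianiMastropietro2006]; HOME/prover-p1b/g5/E3-CERT-NOTE.md §2/§5.
-/

noncomputable section

namespace Summit.HubbardSuperconductivity.HubbardSuperconductivity.Theorems.PerturbedFermiCurve

set_option linter.dupNamespace false -- summit = problem name (single-conjunct summit), D-0017

open Real Set Finset
open Literature.MathematicalPhysics.QuantumLattice Literature.MathematicalPhysics.QuantumLattice.BandSectorCounting
open Summit.HubbardSuperconductivity.HubbardSuperconductivity.Theorems.DispersionFlow
open Summit.HubbardSuperconductivity.HubbardSuperconductivity.Theorems.KLRegimeSplit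

/-- Powers of `2^{N+1}`: `4^{N+1} = (2^{N+1})²`, `16^{N+1} = (2^{N+1})⁴`, `4^{N+1} ≤ (2^{N+1})³`. -/
theorem pow_two_pow_facts (N : ℕ) :
    (4 : ℝ) ^ (N + 1) = ((2 : ℝ) ^ (N + 1)) ^ 2 ∧ (16 : ℝ) ^ (N + 1) = ((2 : ℝ) ^ (N + 1)) ^ 4 ∧
      (4 : ℝ) ^ (N + 1) ≤ ((2 : ℝ) ^ (N + 1)) ^ 3 := by
  have h4 : (4 : ℝ) ^ (N + 1) = ((2 : ℝ) ^ (N + 1)) ^ 2 := by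
    rw [pow_right_comm]; norm_num
  have h16 : (16 : ℝ) ^ (N + 1) = ((2 : ℝ) ^ (N + 1)) ^ 4 := by
    rw [pow_right_comm]; norm_num
  refine ⟨h4, h16, ?_⟩
  rw [h4]
  exact pow_le_pow_right₀ (one_le_pow₀ (by norm_num)) (by norm_num)

/-- Relaxing a quotient: `x ≤ y`, `0 ≤ y`, `0 < d ≤ b` give `x/b ≤ y/d`. -/
theorem div_relax {x y b d : ℝ} (hxy : x ≤ y) (hy : 0 ≤ y) (hd : 0 < d) (hdb : d ≤ b) : x / b ≤ y / d :=
  (div_le_div_of_nonneg_right hxy (hd.trans_le hdb).le).trans (div_le_div_of_nonneg_left hy hd hdb)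

/-- The order-3 numerator at worst case: `A ≤ 1/20`, `A₃ ≤ G·P` (`P ≥ 1`) — linear in `A₃`, so one factor `P`. -/
theorem num_three_le {A A₃ G r₁ r₂ s P : ℝ} (hA : A ≤ 1 / 20) (hA₃ : A₃ ≤ G * P)
    (hP : 1 ≤ P) (hr₁ : 0 ≤ r₁) (hr₂ : 0 ≤ r₂) (hs : 0 ≤ s) :
    (4 + 8 * A₃) * (r₁ + s) ^ 3 + 3 * (4 + 4 * A) * (r₁ + s) * (r₂ + 2 * r₁ + s) + (4 + 2 * A) * (3 * r₂ + 3 * r₁ + s) ≤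
      ((4 + 8 * G) * (r₁ + s) ^ 3 + 3 * (4 + 1 / 5) * (r₁ + s) * (r₂ + 2 * r₁ + s) + (4 + 1 / 10) * (3 * r₂ + 3 * r₁ + s)) * P := by
  have hK1 : 0 ≤ (r₁ + s) ^ 3 := by positivity
  have hK12 : 0 ≤ (r₁ + s) * (r₂ + 2 * r₁ + s) := by positivity
  have hL : 0 ≤ 3 * r₂ + 3 * r₁ + s := by positivity
  have c1 : 4 + 8 * A₃ ≤ (4 + 8 * G) * P := by linarith only [hA₃, hP]
  have e1 : (4 + 8 * A₃) * (r₁ + s) ^ 3 ≤ (4 + 8 * G) * (r₁ + s) ^ 3 * P := by nlinarith only [c1, hK1]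
  have c2 : 3 * (4 + 4 * A) ≤ 3 * (4 + 1 / 5) * P := by linarith only [hA, hP]
  have e2 : 3 * (4 + 4 * A) * (r₁ + s) * (r₂ + 2 * r₁ + s) ≤ 3 * (4 + 1 / 5) * (r₁ + s) * (r₂ + 2 * r₁ + s) * P := by
    nlinarith only [c2, hK12]
  have c3 : 4 + 2 * A ≤ (4 + 1 / 10) * P := by linarith only [hA, hP]
  have e3 : (4 + 2 * A) * (3 * r₂ + 3 * r₁ + s) ≤ (4 + 1 / 10) * (3 * r₂ + 3 * r₁ + s) * P := by nlinarith only [c3, hL]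
  linarith only [e1, e2, e3]

/-- The order-4 numerator at worst case: `A ≤ 1/20`, `A₃ ≤ G₃·P`, `A₄ ≤ G₄·Q`, `R₃ = r₃·P` (`1 ≤ P ≤ Q`) — one factor `Q`. -/
theorem num_four_le {A A₃ A₄ G₃ G₄ r₁ r₂ r₃ s P Q : ℝ} (hA : A ≤ 1 / 20) (hA₃ : A₃ ≤ G₃ * P) (hA₄ : A₄ ≤ G₄ * Q)
    (hG₃ : 0 ≤ G₃) (hP : 1 ≤ P) (hPQ : P ≤ Q) (hr₁ : 0 ≤ r₁) (hr₂ : 0 ≤ r₂) (hr₃ : 0 ≤ r₃) (hs : 0 ≤ s) :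
    (4 + 16 * A₄) * (r₁ + s) ^ 4 + 6 * (4 + 8 * A₃) * (r₁ + s) ^ 2 * (r₂ + 2 * r₁ + s) + 3 * (4 + 4 * A) * (r₂ + 2 * r₁ + s) ^ 2 +
        4 * (4 + 4 * A) * (r₁ + s) * (r₃ * P + 3 * r₂ + 3 * r₁ + s) + (4 + 2 * A) * (4 * (r₃ * P) + 6 * r₂ + 4 * r₁ + s) ≤
      ((4 + 16 * G₄) * (r₁ + s) ^ 4 + 6 * (4 + 8 * G₃) * (r₁ + s) ^ 2 * (r₂ + 2 * r₁ + s) + 3 * (4 + 1 / 5) * (r₂ + 2 * r₁ + s) ^ 2 +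
        4 * (4 + 1 / 5) * (r₁ + s) * (r₃ + 3 * r₂ + 3 * r₁ + s) + (4 + 1 / 10) * (4 * r₃ + 6 * r₂ + 4 * r₁ + s)) * Q := by
  have hQ : 1 ≤ Q := hP.trans hPQ
  have hk1 : 0 ≤ (r₁ + s) ^ 4 := by positivity
  have hk12 : 0 ≤ (r₁ + s) ^ 2 * (r₂ + 2 * r₁ + s) := by positivity
  have hk2 : 0 ≤ (r₂ + 2 * r₁ + s) ^ 2 := sq_nonneg _
  have hk1' : 0 ≤ r₁ + s := by positivity
  have hr₃P : r₃ * P ≤ r₃ * Q := mul_le_mul_of_nonneg_left hPQ hr₃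
  have hr₃Q : r₃ ≤ r₃ * Q := by nlinarith only [hr₃, hQ]
  have hk30 : 0 ≤ r₃ * P + 3 * r₂ + 3 * r₁ + s := by
    have : 0 ≤ r₃ * P := by nlinarith only [hr₃, hP]
    positivity
  have hl40 : 0 ≤ 4 * (r₃ * P) + 6 * r₂ + 4 * r₁ + s := by
    have : 0 ≤ r₃ * P := by nlinarith only [hr₃, hP]
    positivity
  have hrest3 : 3 * r₂ + 3 * r₁ + s ≤ (3 * r₂ + 3 * r₁ + s) * Q := by
    have h0 : 0 ≤ 3 * r₂ + 3 * r₁ + s := by positivity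
    nlinarith only [h0, hQ]
  have hrest4 : 6 * r₂ + 4 * r₁ + s ≤ (6 * r₂ + 4 * r₁ + s) * Q := by
    have h0 : 0 ≤ 6 * r₂ + 4 * r₁ + s := by positivity
    nlinarith only [h0, hQ]
  have hk3 : r₃ * P + 3 * r₂ + 3 * r₁ + s ≤ (r₃ + 3 * r₂ + 3 * r₁ + s) * Q := by linarith only [hr₃P, hrest3]
  have hl4 : 4 * (r₃ * P) + 6 * r₂ + 4 * r₁ + s ≤ (4 * r₃ + 6 * r₂ + 4 * r₁ + s) * Q := by linarith only [hr₃P, hrest4]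
  have c1 : 4 + 16 * A₄ ≤ (4 + 16 * G₄) * Q := by linarith only [hA₄, hQ]
  have e1 : (4 + 16 * A₄) * (r₁ + s) ^ 4 ≤ (4 + 16 * G₄) * (r₁ + s) ^ 4 * Q := by nlinarith only [c1, hk1]
  have c2 : 6 * (4 + 8 * A₃) ≤ 6 * (4 + 8 * G₃) * Q := by nlinarith only [hA₃, hQ, hPQ, hG₃, hP]
  have e2 : 6 * (4 + 8 * A₃) * (r₁ + s) ^ 2 * (r₂ + 2 * r₁ + s) ≤ 6 * (4 + 8 * G₃) * (r₁ + s) ^ 2 * (r₂ + 2 * r₁ + s) * Q := by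
    nlinarith only [c2, hk12]
  have c3 : 3 * (4 + 4 * A) ≤ 3 * (4 + 1 / 5) * Q := by linarith only [hA, hQ]
  have e3 : 3 * (4 + 4 * A) * (r₂ + 2 * r₁ + s) ^ 2 ≤ 3 * (4 + 1 / 5) * (r₂ + 2 * r₁ + s) ^ 2 * Q := by
    nlinarith only [c3, hk2]
  have c4 : 4 * (4 + 4 * A) * (r₁ + s) ≤ 4 * (4 + 1 / 5) * (r₁ + s) := by nlinarith only [hA, hk1']
  have e4 : 4 * (4 + 4 * A) * (r₁ + s) * (r₃ * P + 3 * r₂ + 3 * r₁ + s) ≤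
      4 * (4 + 1 / 5) * (r₁ + s) * (r₃ + 3 * r₂ + 3 * r₁ + s) * Q := by
    have h0 : 0 ≤ 4 * (4 + 1 / 5) * (r₁ + s) := by positivity
    calc 4 * (4 + 4 * A) * (r₁ + s) * (r₃ * P + 3 * r₂ + 3 * r₁ + s)
        ≤ 4 * (4 + 1 / 5) * (r₁ + s) * (r₃ * P + 3 * r₂ + 3 * r₁ + s) := mul_le_mul_of_nonneg_right c4 hk30
      _ ≤ 4 * (4 + 1 / 5) * (r₁ + s) * ((r₃ + 3 * r₂ + 3 * r₁ + s) * Q) := mul_le_mul_of_nonneg_left hk3 h0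
      _ = _ := by ring
  have e5 : (4 + 2 * A) * (4 * (r₃ * P) + 6 * r₂ + 4 * r₁ + s) ≤ (4 + 1 / 10) * (4 * r₃ + 6 * r₂ + 4 * r₁ + s) * Q := by
    calc (4 + 2 * A) * (4 * (r₃ * P) + 6 * r₂ + 4 * r₁ + s) ≤ (4 + 1 / 10) * (4 * (r₃ * P) + 6 * r₂ + 4 * r₁ + s) :=
          mul_le_mul_of_nonneg_right (by linarith only [hA]) hl40
      _ ≤ (4 + 1 / 10) * ((4 * r₃ + 6 * r₂ + 4 * r₁ + s) * Q) := mul_le_mul_of_nonneg_left hl4 (by norm_num)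
      _ = _ := by ring
  linarith only [e1, e2, e3, e4, e5]

/-- The graded constants: `C = max(1, r₁, …, r₄)`, `T = 2^{N+1} ≥ 1`, `P ≤ T³`, `Q = T⁴` give `R_k ≤ 5·(C·T)ᵏ`. -/
theorem graded_consts {C T r₁ r₂ r₃ r₄ P Q : ℝ} (hC1 : 1 ≤ C) (h1 : r₁ ≤ C) (h2 : r₂ ≤ C) (h3 : r₃ ≤ C) (h4 : r₄ ≤ C) (hT1 : 1 ≤ T)
    (hP0 : 0 ≤ P) (hPT : P ≤ T ^ 3) (hQT : Q = T ^ 4) :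
    1 ≤ C * T ∧ r₁ ≤ 5 * (C * T) ∧ r₂ ≤ 5 * (C * T) ^ 2 ∧ r₃ * P ≤ 5 * (C * T) ^ 3 ∧ r₄ * Q ≤ 5 * (C * T) ^ 4 := by
  have hC0 : 0 ≤ C := by linarith
  have hT0 : 0 ≤ T := by linarith
  have hD1 : 1 ≤ C * T := by nlinarith
  have hD0 : 0 ≤ C * T := by positivity
  refine ⟨hD1, by nlinarith, ?_, ?_, ?_⟩
  · have : C * T ≤ (C * T) ^ 2 := by nlinarith
    nlinarith
  · have hC3 : C ≤ C ^ 3 := by nlinarith [one_le_pow₀ (n := 2) hC1]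
    calc r₃ * P ≤ C * T ^ 3 := mul_le_mul h3 hPT hP0 hC0
      _ ≤ C ^ 3 * T ^ 3 := mul_le_mul_of_nonneg_right hC3 (pow_nonneg hT0 3)
      _ = (C * T) ^ 3 := by ring
      _ ≤ 5 * (C * T) ^ 3 := by nlinarith [pow_nonneg hD0 3]
  · have hC4 : C ≤ C ^ 4 := by nlinarith [one_le_pow₀ (n := 3) hC1]
    calc r₄ * Q = r₄ * T ^ 4 := by rw [hQT]
      _ ≤ C * T ^ 4 := mul_le_mul_of_nonneg_right h4 (pow_nonneg hT0 4)
      _ ≤ C ^ 4 * T ^ 4 := mul_le_mul_of_nonneg_right hC4 (pow_nonneg hT0 4)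
      _ = (C * T) ^ 4 := by ring
      _ ≤ 5 * (C * T) ^ 4 := by nlinarith [pow_nonneg hD0 4]

/-- **THE GRADED GROWTH OF THE FRAME'S FERMI-POINT MAP IN THE KL REGIME.**  For every `R` (`Gfr ≥ 0`) there are `c₃, U₀ > 0` and a
constant `C₀ ≥ 1` depending on `R` only such that in the regime, for every `μ ∈ klWindowC`, every `FrameOK R U (nScales β) μ K` frame,
every `1 ≤ i ≤ 4` and every angle, `‖Dⁱ(θ ↦ toLp 2 (klFermiPoint μ K θ))(θ)‖ ≤ (C₀ · 2^{nScales β + 1})ⁱ`.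
[cite: BenfattoGiulianiMastropietro2006, §2.4 Lemma 2.1 (2.40)] -/
theorem fermiPointLp_graded_of_frameOK (R : RenConsts) (hR : ∀ j, 0 ≤ R.Gfr j) :
    ∃ c₃ : ℝ, 0 < c₃ ∧ ∃ U₀ : ℝ, 0 < U₀ ∧ ∃ C₀ : ℝ, 1 ≤ C₀ ∧
      ∀ c : ℝ, 0 < c → c ≤ c₃ → ∀ U : ℝ, 0 < U → U ≤ U₀ → ∀ β : ℝ, klBetaMin ≤ β → β ≤ Real.exp (c / U ^ 2) →
      ∀ μ ∈ klWindowC, ∀ K : TrigPolyC4v, FrameOK R U (nScales β) μ K →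
        ∀ i : ℕ, 1 ≤ i → i ≤ 4 → ∀ θ : ℝ,
          ‖iteratedFDeriv ℝ i (fun θ : ℝ => (WithLp.toLp 2 (klFermiPoint μ K θ) : Momentum)) θ‖ ≤
            (C₀ * (2 : ℝ) ^ (nScales β + 1)) ^ i := by
  have ha : (-4 : ℝ) < -1.1 := by norm_num
  have hab : (-1.1 : ℝ) ≤ -0.1 := by norm_num
  have hb : (-0.1 : ℝ) < 0 := by norm_num
  set B := bandBounds ha hab hb with hBdef
  have hDt := B.Dtmin_pos
  obtain ⟨c₃, hc₃, U₀, hU₀, hsz⟩ := frame_sizes_of_frameOK R hR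
  have hG3 := hR 3; have hG4 := hR 4
  -- worst-case data (functions of `R` and the window only)
  obtain ⟨d, hd⟩ : ∃ d : ℝ, d = B.Dtmin / 2 := ⟨_, rfl⟩
  have hdpos : 0 < d := by rw [hd]; linarith
  obtain ⟨s, hs⟩ : ∃ s : ℝ, s = π * Real.sqrt 2 := ⟨_, rfl⟩
  have hs0 : 0 < s := by rw [hs]; positivity
  obtain ⟨r₁, hr₁⟩ : ∃ r : ℝ, r = (4 + 1 / 10) * s / d := ⟨_, rfl⟩
  have hr₁0 : 0 ≤ r₁ := by rw [hr₁]; positivity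
  obtain ⟨r₂, hr₂⟩ : ∃ r : ℝ, r = ((4 + 1 / 5) * (r₁ + s) ^ 2 + (4 + 1 / 10) * (2 * r₁ + s)) / d := ⟨_, rfl⟩
  have hr₂0 : 0 ≤ r₂ := by rw [hr₂]; positivity
  obtain ⟨r₃, hr₃⟩ : ∃ r : ℝ, r = ((4 + 8 * R.Gfr 3) * (r₁ + s) ^ 3 + 3 * (4 + 1 / 5) * (r₁ + s) * (r₂ + 2 * r₁ + s) +
      (4 + 1 / 10) * (3 * r₂ + 3 * r₁ + s)) / d := ⟨_, rfl⟩
  have hr₃0 : 0 ≤ r₃ := by rw [hr₃]; positivity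
  obtain ⟨r₄, hr₄⟩ : ∃ r : ℝ, r = ((4 + 16 * R.Gfr 4) * (r₁ + s) ^ 4 + 6 * (4 + 8 * R.Gfr 3) * (r₁ + s) ^ 2 * (r₂ + 2 * r₁ + s) +
      3 * (4 + 1 / 5) * (r₂ + 2 * r₁ + s) ^ 2 + 4 * (4 + 1 / 5) * (r₁ + s) * (r₃ + 3 * r₂ + 3 * r₁ + s) +
      (4 + 1 / 10) * (4 * r₃ + 6 * r₂ + 4 * r₁ + s)) / d := ⟨_, rfl⟩
  have hr₄0 : 0 ≤ r₄ := by rw [hr₄]; positivity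
  obtain ⟨C, hC⟩ : ∃ C : ℝ, C = max 1 (max r₁ (max r₂ (max r₃ r₄))) := ⟨_, rfl⟩
  have hC1 : 1 ≤ C := by rw [hC]; exact le_max_left _ _
  have hCr₁ : r₁ ≤ C := by rw [hC]; exact le_trans (le_max_left _ _) (le_max_right _ _)
  have hCr₂ : r₂ ≤ C := by rw [hC]; exact le_trans (le_trans (le_max_left _ _) (le_max_right _ _)) (le_max_right _ _)
  have hCr₃ : r₃ ≤ C := by
    rw [hC]; exact le_trans (le_trans (le_trans (le_max_left _ _) (le_max_right _ _)) (le_max_right _ _)) (le_max_right _ _)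
  have hCr₄ : r₄ ≤ C := by
    rw [hC]; exact le_trans (le_trans (le_trans (le_max_right _ _) (le_max_right _ _)) (le_max_right _ _)) (le_max_right _ _)
  refine ⟨c₃, hc₃, min U₀ 1, lt_min hU₀ one_pos, 20 * C, by linarith, ?_⟩
  intro c hc hcle U hU hUle β hβmin hβc μ hμ K hK i hi1 hi4 θ
  have hU1 : U ≤ 1 := hUle.trans (min_le_right _ _)
  have hUU₀ : U ≤ U₀ := hUle.trans (min_le_left _ _)
  obtain ⟨hAf, hA20, hADt, hhalf, ⟨hlo, hhi⟩, hA3f, hA4f⟩ := hsz c hc hcle U hU hUU₀ β hβmin hβc μ hμ K hK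
  obtain ⟨A, hAdef⟩ : ∃ A : ℝ, A = 2 * R.Gfr 0 * |U| + 2 * R.Gfr 1 * U ^ 2 + R.Gfr 2 * (c / Real.log 4) := ⟨_, rfl⟩
  rw [← hAdef] at hAf hA20 hADt hhalf hlo hhi
  obtain ⟨P, hP⟩ : ∃ P : ℝ, P = (4 : ℝ) ^ (nScales β + 1) := ⟨_, rfl⟩
  obtain ⟨Q, hQ⟩ : ∃ Q : ℝ, Q = (16 : ℝ) ^ (nScales β + 1) := ⟨_, rfl⟩
  have hP1 : 1 ≤ P := by rw [hP]; exact one_le_pow₀ (by norm_num)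
  have hPQ : P ≤ Q := by rw [hP, hQ]; exact pow_le_pow_left₀ (by norm_num) (by norm_num) _
  have hP0 : (0 : ℝ) ≤ P := zero_le_one.trans hP1
  -- the order-3/4 sizes, relaxed: `A₃ ≤ Gfr₃·P`, `A₄ ≤ Gfr₄·Q`
  obtain ⟨A₃, hA₃⟩ : ∃ A₃ : ℝ, A₃ = R.Gfr 3 * U ^ 2 * (P / 3) := ⟨_, rfl⟩
  obtain ⟨A₄, hA₄⟩ : ∃ A₄ : ℝ, A₄ = R.Gfr 4 * U ^ 2 * (Q / 15) := ⟨_, rfl⟩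
  have hA3f' : ∀ p : Momentum, ‖iteratedFDeriv ℝ 3 (frameShift K) p‖ ≤ A₃ := by rw [hA₃, hP]; exact hA3f
  have hA4f' : ∀ p : Momentum, ‖iteratedFDeriv ℝ 4 (frameShift K) p‖ ≤ A₄ := by rw [hA₄, hQ]; exact hA4f
  have hU2 : U ^ 2 ≤ 1 := by nlinarith only [hU1, hU]
  have hA₃le : A₃ ≤ R.Gfr 3 * P := by
    have h1 : U ^ 2 * (P / 3) ≤ P := by nlinarith only [hU2, hP0, sq_nonneg U]
    rw [hA₃, mul_assoc]
    exact mul_le_mul_of_nonneg_left h1 hG3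
  have hA₄le : A₄ ≤ R.Gfr 4 * Q := by
    have hQ0 : (0 : ℝ) ≤ Q := hP0.trans hPQ
    have h1 : U ^ 2 * (Q / 15) ≤ Q := by nlinarith only [hU2, hQ0, sq_nonneg U]
    rw [hA₄, mul_assoc]
    exact mul_le_mul_of_nonneg_left h1 hG4
  have hden : d ≤ B.Dtmin - 2 * A := by rw [hd]; exact hhalf
  have hdenpos : 0 < B.Dtmin - 2 * A := hdpos.trans_le hden
  -- order 1
  have hR₁ : |deriv (perturbedFermiRadius (fun p : Fin 2 → ℝ => -K.eval p) μ) θ| ≤ r₁ := by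
    have h := abs_deriv_frameRadius_le_uniform B hAf hADt hlo hhi θ
    rw [← hs] at h
    refine h.trans ?_
    rw [hr₁]
    exact div_relax (mul_le_mul_of_nonneg_right (by linarith only [hA20]) hs0.le) (by positivity) hdpos hden
  -- order 2
  have hR₂ : |deriv (deriv (perturbedFermiRadius (fun p : Fin 2 → ℝ => -K.eval p) μ)) θ| ≤ r₂ := by
    have h := abs_deriv_two_frameRadius_le B hAf hADt hlo hhi hR₁
    rw [← hs] at h
    refine h.trans ?_
    rw [hr₂]
    have hK : 0 ≤ (r₁ + s) ^ 2 := sq_nonneg _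
    have hL : 0 ≤ 2 * r₁ + s := by positivity
    exact div_relax (add_le_add (mul_le_mul_of_nonneg_right (by linarith only [hA20]) hK)
      (mul_le_mul_of_nonneg_right (by linarith only [hA20]) hL)) (by positivity) hdpos hden
  -- order 3: `R₃ ≤ r₃·P`
  have hR₃ : |deriv (deriv (deriv (perturbedFermiRadius (fun p : Fin 2 → ℝ => -K.eval p) μ))) θ| ≤ r₃ * P := by
    have h := abs_deriv_three_frameRadius_le B hAf hADt hlo hhi hA3f' hR₁ hR₂
    rw [← hs] at h
    refine h.trans ?_
    have hnum := num_three_le hA20 hA₃le hP1 hr₁0 hr₂0 hs0.le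
    refine (div_relax hnum (by positivity) hdpos hden).trans (le_of_eq ?_)
    rw [hr₃]; ring
  -- order 4: `R₄ ≤ r₄·Q`
  have hR₄ : |deriv (deriv (deriv (deriv (perturbedFermiRadius (fun p : Fin 2 → ℝ => -K.eval p) μ)))) θ| ≤ r₄ * Q := by
    have h := abs_deriv_four_frameRadius_le B hAf hADt hlo hhi hA3f' hA4f' hR₁ hR₂ hR₃
    rw [← hs] at h
    refine h.trans ?_
    have hnum := num_four_le hA20 hA₃le hA₄le hG3 hP1 hPQ hr₁0 hr₂0 hr₃0 hs0.le
    have hQ0 : (0 : ℝ) ≤ Q := hP0.trans hPQ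
    refine (div_relax hnum (by positivity) hdpos hden).trans (le_of_eq ?_)
    rw [hr₄]; ring
  -- the graded constant `D = C·2^{N+1}`
  obtain ⟨h4, h16, h48⟩ := pow_two_pow_facts (nScales β)
  obtain ⟨T, hT⟩ : ∃ T : ℝ, T = (2 : ℝ) ^ (nScales β + 1) := ⟨_, rfl⟩
  have hT1 : 1 ≤ T := by rw [hT]; exact one_le_pow₀ (by norm_num)
  have hPT : P ≤ T ^ 3 := by rw [hP, hT]; exact h48
  have hQT : Q = T ^ 4 := by rw [hQ, hT]; exact h16
  obtain ⟨hD1, g1, g2, g3, g4⟩ := graded_consts hC1 hCr₁ hCr₂ hCr₃ hCr₄ hT1 hP0 hPT hQT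
  have h := norm_iteratedFDeriv_fermiPointLp_le_of_tower B hAf hADt hlo hhi hD1 hR₁ hR₂ hR₃ hR₄ g1 g2 g3 g4 hi1 hi4
  calc _ ≤ (20 * (C * T)) ^ i := h
    _ = (20 * C * (2 : ℝ) ^ (nScales β + 1)) ^ i := by rw [hT]; ring

end Summit.HubbardSuperconductivity.HubbardSuperconductivity.Theorems.PerturbedFermiCurve

end
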